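import Summits.QuantumFields.BalabanUV.Beta.GAN24.CapacitanceSolve

/-!
# `BalabanUV.Beta.GAN24.CapacitanceClosedForm` — binder row G-an2-4 / (CONV-C), road P1-fibre, sub-part L08b of the crux A4 of `SKELETON-P1.md`:
# the capacitance matrix of the per-fibre arrow system is «DIAGONAL + RANK-ONE-BORDERED» and EXPLICITLY invertible

NOT IN PRINT; OUR PROOF ATTEMPT.  HONEST FRAMING (cell contract, verbatim): «discharging `BetaPertH` makes Bałaban's UV stability UNCONDITIONAL — a real
constructive-QFT result; it is NOT the continuum limit and NOT the Clay problem.»  HONEST DEPENDENCY (verbatim): «continuum YM on T⁴ ⇐ BetaPertH ∧ nine spine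
estimates (0/9 proved); BetaPertH ⇐ (D1) ∧ (D4) ∧ CAP+tail; G-an2-4 gates asym, D1 and NE2/3/4.»  [folklore] finite-dimensional algebra over `ℂ` (no estimate beyond
the triangle inequality, no cited fact, no wall binder, no `def … : Prop` hypothesis).  NOT summit progress; nothing of (CONV-C)'s K-slot is discharged here.

## What is proved
`GAN24/CapacitanceSolve` (leaf P1-L05 (a)) reduces the per-fibre arrow system of the Bloch fibre matrix of the typed `U = 1` KKT system to the
`(D+1)×(D+1)` CAPACITANCE SYSTEM `[[capP, capV],[capW, 0]] (φ; c) = (q − srcQ; −ρ − srcM)` (abstract alias index `ι`, abstract border weights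
`wE, wG, wM, wQ`).  THIS FILE shows that two TELESCOPING IDENTITIES of the weights,
  (T1) `wQ m κ · ∂_{mκ} = wM m · δ κ`,        (T2) `∂♭_{mκ} · wE m κ = wG m · δ' κ`,
with `δ, δ' : Fin D → ℂ` INDEPENDENT of the alias `m` (for the concrete S1a weights `wQ = S·s_κ`, `wM = S`, `wE = χ̂·s♭_κ`, `wG = χ̂` these are the
geometric-sum identities `s_κ(m)(e^{ik_{m,κ}} − 1) = e^{ip_κ} − 1` with `δ = ∂̂(p)`, `δ' = ∂̂♭(p)` the COARSE-momentum symbols, every `N`, every complex `p`),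
force the structure (§2)  `capV κ = σ·δ κ`,  `capW κ = σ·δ' κ`,  `capP κ l = a_κ·[κ = l] − (σ/2)·δ κ·δ' l`
with the `D + 1` SCALAR alias sums `a_κ = Σ_m wQ_{mκ} wE_{mκ}/(2L_m)` (`aDiag`) and `σ = Σ_m wM_m wG_m/L_m²` (`sigma`): the capacitance matrix is
`[[diag(a) − (σ/2) δ δ'ᵀ, σ δ],[σ δ'ᵀ, 0]]`, its border EXACTLY longitudinal.  Hence (§1, §3), with `h = Σ_κ δ_κ δ'_κ/a_κ` (`hSum`), whenever
`a_κ ≠ 0`, `σ ≠ 0`, `h ≠ 0` the capacitance system has a UNIQUE solution in CLOSED FORM (`phiCF`, `cCF`; `capSolves_iff_closedForm`: substituting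
`δ'·φ = R/σ` from the `c`-row folds the rank-one term into `u = σc − R/2` and leaves the bordered DIAGONAL system `[[diag a, δ],[δ'ᵀ, 0]]`); blockwise (§5)
  `(Cap⁻¹)_φφ = A⁻¹ − A⁻¹δ δ'ᵀA⁻¹/h`,  `(Cap⁻¹)_φc = A⁻¹δ/(σh)`,  `(Cap⁻¹)_cφ = δ'ᵀA⁻¹/(σh)`,  `(Cap⁻¹)_cc = 1/(2σ) − 1/(σ²h)`  (`A = diag a`);
the homogeneous capacitance system — and, by leaf-15's `arrow_injective_iff_cap_injective`, the homogeneous ARROW system — is injective under the three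
non-vanishings (§4); and (§6) the blocks obey the NO-CANCELLATION bounds `α + α²ε²η`, `αεςη`, `αεςη`, `ς/2 + ς²η` from `‖a_κ⁻¹‖ ≤ α`, `‖δ_κ‖, ‖δ'_κ‖ ≤ ε`,
`‖σ⁻¹‖ ≤ ς`, `‖h⁻¹‖ ≤ η`.  For the crux (leaf P1-L08): N-uniform bounds of `Cap⁻¹` ARE two-sided N-uniform bounds of the positive scalar alias sums
`a_κ(p)`, `σ(p)` on `BZ ∖ {0}` (at real `p`: `α ~ |p|²/N^{D+4}`, `ς ~ |p|⁴/N^{D+4}`, `η ~ N^{D+4}/|p|⁴`, `ε ~ |p|`, reproducing `SKELETON-P1.md` A4′(iii)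
`(Cap⁻¹)_φφ = O(|p|²/N^{D+4})`, `(Cap⁻¹)_φc = O(|p|³/N^{D+4})`).  Those scalar bounds are NOT proved here.
-/

open Finset
open scoped BigOperators

namespace Summit.QuantumFields.BalabanUV.Beta.GAN24.CapacitanceClosedForm

open FibreBlockSolve (dot)
open CapacitanceSolve (Fibre capP capPm capV capW srcQ srcM CapSolves ArrowSolves arrow_injective_iff_cap_injective)

variable {D : ℕ} {ι : Type*}

/-! ## §1 The bordered diagonal system `[[diag a − (σ/2)δδ'ᵀ, σδ],[σδ'ᵀ, 0]] (φ; c) = (Q; R)` and its closed-form solution -/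

/-- [folklore] `h = Σ_κ δ_κ δ'_κ / a_κ` — the scalar `δ'ᵀ A⁻¹ δ` of the bordered diagonal system. -/
noncomputable def hSum (a δ δ' : Fin D → ℂ) : ℂ := ∑ κ, δ κ * δ' κ / a κ

/-- [folklore] The folded unknown `u = σc − R/2` in closed form: `u = (Σ_κ δ'_κ Q_κ/a_κ − R/σ)/h`. -/
noncomputable def uCF (a δ δ' : Fin D → ℂ) (σ : ℂ) (Q : Fin D → ℂ) (R : ℂ) : ℂ :=
  ((∑ κ, δ' κ * Q κ / a κ) - R / σ) / hSum a δ δ'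

/-- [folklore] CLOSED-FORM `c`: `c = (u + R/2)/σ`. -/
noncomputable def cCF (a δ δ' : Fin D → ℂ) (σ : ℂ) (Q : Fin D → ℂ) (R : ℂ) : ℂ := (uCF a δ δ' σ Q R + R / 2) / σ

/-- [folklore] CLOSED-FORM `φ`: `φ_κ = (Q_κ − δ_κ u)/a_κ`. -/
noncomputable def phiCF (a δ δ' : Fin D → ℂ) (σ : ℂ) (Q : Fin D → ℂ) (R : ℂ) : Fin D → ℂ :=
  fun κ => (Q κ - δ κ * uCF a δ δ' σ Q R) / a κ

/-- [folklore] The longitudinal content of the closed-form `φ`: `δ'·φ = R/σ`. -/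
theorem dot_phiCF (a δ δ' : Fin D → ℂ) (σ : ℂ) (Q : Fin D → ℂ) (R : ℂ) (hh : hSum a δ δ' ≠ 0) :
    dot δ' (phiCF a δ δ' σ Q R) = R / σ := by
  have hsplit : dot δ' (phiCF a δ δ' σ Q R) = (∑ κ, δ' κ * Q κ / a κ) - uCF a δ δ' σ Q R * hSum a δ δ' := by
    unfold dot phiCF hSum
    rw [Finset.mul_sum, ← Finset.sum_sub_distrib]
    exact Finset.sum_congr rfl fun κ _ => by ring
  rw [hsplit, uCF, div_mul_cancel₀ _ hh]
  ring

/-- [folklore] **THE BORDERED DIAGONAL SYSTEM IS SOLVED BY THE CLOSED FORM, AND ONLY BY IT**: for `a_κ ≠ 0`, `σ ≠ 0`, `h ≠ 0`,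
`(∀ κ, a_κ φ_κ − (σ/2) δ_κ (δ'·φ) + σ δ_κ c = Q_κ) ∧ σ (δ'·φ) = R  ↔  φ = phiCF ∧ c = cCF`. -/
theorem bordered_iff_closedForm (a δ δ' : Fin D → ℂ) (σ : ℂ) (Q : Fin D → ℂ) (R : ℂ)
    (ha : ∀ κ, a κ ≠ 0) (hσ : σ ≠ 0) (hh : hSum a δ δ' ≠ 0) (φ : Fin D → ℂ) (c : ℂ) :
    ((∀ κ, a κ * φ κ - σ / 2 * δ κ * dot δ' φ + σ * δ κ * c = Q κ) ∧ σ * dot δ' φ = R)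
      ↔ (φ = phiCF a δ δ' σ Q R ∧ c = cCF a δ δ' σ Q R) := by
  have e4 : ∀ κ, σ / 2 * δ κ * (R / σ) = δ κ * (R / 2) := by
    intro κ
    rw [show σ / 2 * δ κ * (R / σ) = (σ * σ⁻¹) * (δ κ * (R / 2)) by ring, mul_inv_cancel₀ hσ, one_mul]
  constructor
  · rintro ⟨hrow, hcrow⟩
    have hdot : dot δ' φ = R / σ := by
      rw [eq_div_iff hσ, mul_comm]
      exact hcrow
    have haφ : ∀ κ, a κ * φ κ = Q κ - δ κ * (σ * c - R / 2) := by
      intro κ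
      have hκ := hrow κ
      rw [hdot, e4 κ] at hκ
      linear_combination hκ
    have hφ : ∀ κ, φ κ = (Q κ - δ κ * (σ * c - R / 2)) / a κ := by
      intro κ
      rw [eq_div_iff (ha κ), mul_comm]
      exact haφ κ
    have hu : σ * c - R / 2 = uCF a δ δ' σ Q R := by
      have hsum : dot δ' φ = (∑ κ, δ' κ * Q κ / a κ) - (σ * c - R / 2) * hSum a δ δ' := by
        unfold dot hSum
        rw [Finset.mul_sum, ← Finset.sum_sub_distrib]
        exact Finset.sum_congr rfl fun κ _ => by rw [hφ κ]; ring
      rw [hdot] at hsum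
      unfold uCF
      rw [eq_div_iff hh]
      linear_combination hsum
    refine ⟨funext fun κ => ?_, ?_⟩
    · show φ κ = (Q κ - δ κ * uCF a δ δ' σ Q R) / a κ
      rw [hφ κ, hu]
    · unfold cCF
      rw [← hu, eq_div_iff hσ]
      ring
  · rintro ⟨rfl, rfl⟩
    have hdot := dot_phiCF a δ δ' σ Q R hh
    refine ⟨fun κ => ?_, ?_⟩
    · have e1 : a κ * phiCF a δ δ' σ Q R κ = Q κ - δ κ * uCF a δ δ' σ Q R := by
        unfold phiCF; rw [← mul_div_assoc, mul_div_cancel_left₀ _ (ha κ)]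
      have e3 : σ * cCF a δ δ' σ Q R = uCF a δ δ' σ Q R + R / 2 := by
        unfold cCF; rw [← mul_div_assoc, mul_div_cancel_left₀ _ hσ]
      rw [hdot]
      linear_combination e1 + δ κ * e3 - e4 κ
    · rw [hdot, ← mul_div_assoc, mul_div_cancel_left₀ _ hσ]

/-! ## §2 Structure of the capacitance matrix under the telescoping identities -/

variable (F : Fibre D ι)

/-- [folklore] The diagonal alias sum `a_κ = Σ_m wQ_{mκ} wE_{mκ}/(2L_m)` (concrete weights at real `p`: `Σ_m |S_m|² |s_κ(m)|²/(N^D·2L_m) > 0`). -/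
noncomputable def aDiag [Fintype ι] (κ : Fin D) : ℂ := ∑ m, F.wQ m κ * F.wE m κ / (2 * F.L m)

/-- [folklore] The border alias sum `σ = Σ_m wM_m wG_m/L_m²` (concrete weights at real `p`: `Σ_m |S_m|²/(N^D·L_m²) > 0`). -/
noncomputable def sigma [Fintype ι] : ℂ := ∑ m, F.wM m * F.wG m / F.L m ^ 2

/-- [folklore] **BORDER COLUMN IS LONGITUDINAL**: under (T1), `capV κ = σ·δ_κ`. -/
theorem capV_eq [Fintype ι] (δ : Fin D → ℂ) (hT1 : ∀ m κ, F.wQ m κ * F.dd m κ = F.wM m * δ κ) (κ : Fin D) :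
    capV F κ = sigma F * δ κ := by
  unfold capV sigma
  rw [Finset.sum_mul]
  refine Finset.sum_congr rfl fun m _ => ?_
  have h := hT1 m κ
  have e : F.wQ m κ * F.dd m κ * F.wG m / F.L m ^ 2 = (F.wQ m κ * F.dd m κ) * F.wG m / F.L m ^ 2 := by ring
  rw [e, h]
  ring

/-- [folklore] **BORDER ROW IS LONGITUDINAL**: under (T2), `capW κ = σ·δ'_κ`. -/
theorem capW_eq [Fintype ι] (δ' : Fin D → ℂ) (hT2 : ∀ m κ, F.db m κ * F.wE m κ = F.wG m * δ' κ) (κ : Fin D) :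
    capW F κ = sigma F * δ' κ := by
  unfold capW sigma
  rw [Finset.sum_mul]
  refine Finset.sum_congr rfl fun m _ => ?_
  have h := hT2 m κ
  have e : F.wM m * F.db m κ * F.wE m κ / F.L m ^ 2 = F.wM m * (F.db m κ * F.wE m κ) / F.L m ^ 2 := by ring
  rw [e, h]
  ring

/-- [folklore] Summandwise structure of `capP`: `capPm m κ l = [κ = l]·wQ_{mκ}wE_{mκ}/(2L_m) − wM_m wG_m δ_κ δ'_l/(2L_m²)`. -/
theorem capPm_eq (δ δ' : Fin D → ℂ) (hT1 : ∀ m κ, F.wQ m κ * F.dd m κ = F.wM m * δ κ)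
    (hT2 : ∀ m κ, F.db m κ * F.wE m κ = F.wG m * δ' κ) (m : ι) (κ l : Fin D) :
    capPm F m κ l = (if κ = l then F.wQ m κ * F.wE m κ / (2 * F.L m) else 0) - F.wM m * F.wG m / F.L m ^ 2 / 2 * δ κ * δ' l := by
  have hL := F.L_ne m
  have h1 := hT1 m κ
  have h2 := hT2 m l
  unfold capPm
  have e : F.wQ m κ * ((if κ = l then 1 else 0) - F.dd m κ * F.db m l / F.L m) * F.wE m l / (2 * F.L m)
      = (if κ = l then F.wQ m κ * F.wE m l / (2 * F.L m) else 0) - (F.wQ m κ * F.dd m κ) * (F.db m l * F.wE m l) / F.L m / (2 * F.L m) := by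
    split_ifs <;> ring
  rw [e, h1, h2]
  split_ifs with hκl
  · subst hκl; ring
  · ring

/-- [folklore] **DIAGONAL + RANK ONE**: under (T1) and (T2), `capP κ l = a_κ·[κ = l] − (σ/2)·δ_κ δ'_l`. -/
theorem capP_eq [Fintype ι] (δ δ' : Fin D → ℂ) (hT1 : ∀ m κ, F.wQ m κ * F.dd m κ = F.wM m * δ κ)
    (hT2 : ∀ m κ, F.db m κ * F.wE m κ = F.wG m * δ' κ) (κ l : Fin D) :
    capP F κ l = (if κ = l then aDiag F κ else 0) - sigma F / 2 * δ κ * δ' l := by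
  unfold capP
  simp only [capPm_eq F δ δ' hT1 hT2, Finset.sum_sub_distrib]
  congr 1
  · split_ifs with hκl
    · rfl
    · simp
  · unfold sigma
    rw [Finset.sum_div, Finset.sum_mul, Finset.sum_mul]

/-- [folklore] The `φ`-rows of the capacitance system in structured form: `Σ_l capP κ l φ_l = a_κ φ_κ − (σ/2) δ_κ (δ'·φ)`. -/
theorem sum_capP_mul [Fintype ι] (δ δ' : Fin D → ℂ) (hT1 : ∀ m κ, F.wQ m κ * F.dd m κ = F.wM m * δ κ)
    (hT2 : ∀ m κ, F.db m κ * F.wE m κ = F.wG m * δ' κ) (φ : Fin D → ℂ) (κ : Fin D) :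
    ∑ l, capP F κ l * φ l = aDiag F κ * φ κ - sigma F / 2 * δ κ * dot δ' φ := by
  simp only [capP_eq F δ δ' hT1 hT2, sub_mul, Finset.sum_sub_distrib]
  congr 1
  · simp [ite_mul, Finset.sum_ite_eq]
  · unfold dot
    rw [Finset.mul_sum]
    exact Finset.sum_congr rfl fun l _ => by ring

/-- [folklore] The `c`-row of the capacitance system in structured form: `Σ_κ capW κ φ_κ = σ (δ'·φ)`. -/
theorem sum_capW_mul [Fintype ι] (δ' : Fin D → ℂ) (hT2 : ∀ m κ, F.db m κ * F.wE m κ = F.wG m * δ' κ) (φ : Fin D → ℂ) :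
    ∑ κ, capW F κ * φ κ = sigma F * dot δ' φ := by
  simp only [capW_eq F δ' hT2]
  unfold dot
  rw [Finset.mul_sum]
  exact Finset.sum_congr rfl fun κ _ => by ring

/-! ## §3 The capacitance system IS the bordered diagonal system; closed-form solution -/

/-- [folklore] Under (T1)/(T2) the capacitance system `CapSolves` is LITERALLY the bordered diagonal system of §1 with data
`(a, δ, δ', σ) = (aDiag, δ, δ', sigma)` and right-hand sides `Q = q − srcQ`, `R = −ρ − srcM`. -/
theorem capSolves_iff_bordered [Fintype ι] (δ δ' : Fin D → ℂ) (hT1 : ∀ m κ, F.wQ m κ * F.dd m κ = F.wM m * δ κ)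
    (hT2 : ∀ m κ, F.db m κ * F.wE m κ = F.wG m * δ' κ) (f : ι → Fin D → ℂ) (γ : ι → ℂ) (ρ : ℂ) (q : Fin D → ℂ)
    (φ : Fin D → ℂ) (c : ℂ) :
    CapSolves F f γ ρ q φ c ↔
      ((∀ κ, aDiag F κ * φ κ - sigma F / 2 * δ κ * dot δ' φ + sigma F * δ κ * c = q κ - srcQ F f γ κ)
        ∧ sigma F * dot δ' φ = -ρ - srcM F f) := by
  unfold CapSolves
  simp only [sum_capP_mul F δ δ' hT1 hT2, sum_capW_mul F δ' hT2, capV_eq F δ hT1]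

/-- [folklore] **CLOSED-FORM SOLUTION OF THE CAPACITANCE SYSTEM** (existence and uniqueness): under (T1)/(T2) and `a_κ ≠ 0`, `σ ≠ 0`, `h ≠ 0`,
`CapSolves F f γ ρ q φ c ↔ φ = phiCF a δ δ' σ Q R ∧ c = cCF a δ δ' σ Q R` with `Q = q − srcQ`, `R = −ρ − srcM`. -/
theorem capSolves_iff_closedForm [Fintype ι] (δ δ' : Fin D → ℂ) (hT1 : ∀ m κ, F.wQ m κ * F.dd m κ = F.wM m * δ κ)
    (hT2 : ∀ m κ, F.db m κ * F.wE m κ = F.wG m * δ' κ) (ha : ∀ κ, aDiag F κ ≠ 0) (hσ : sigma F ≠ 0)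
    (hh : hSum (aDiag F) δ δ' ≠ 0) (f : ι → Fin D → ℂ) (γ : ι → ℂ) (ρ : ℂ) (q : Fin D → ℂ) (φ : Fin D → ℂ) (c : ℂ) :
    CapSolves F f γ ρ q φ c ↔
      (φ = phiCF (aDiag F) δ δ' (sigma F) (fun κ => q κ - srcQ F f γ κ) (-ρ - srcM F f)
        ∧ c = cCF (aDiag F) δ δ' (sigma F) (fun κ => q κ - srcQ F f γ κ) (-ρ - srcM F f)) := by
  rw [capSolves_iff_bordered F δ δ' hT1 hT2]
  exact bordered_iff_closedForm (aDiag F) δ δ' (sigma F) (fun κ => q κ - srcQ F f γ κ) (-ρ - srcM F f) ha hσ hh φ c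

/-- [folklore] EXISTENCE, packaged: the closed form solves the capacitance system. -/
theorem capSolves_closedForm [Fintype ι] (δ δ' : Fin D → ℂ) (hT1 : ∀ m κ, F.wQ m κ * F.dd m κ = F.wM m * δ κ)
    (hT2 : ∀ m κ, F.db m κ * F.wE m κ = F.wG m * δ' κ) (ha : ∀ κ, aDiag F κ ≠ 0) (hσ : sigma F ≠ 0)
    (hh : hSum (aDiag F) δ δ' ≠ 0) (f : ι → Fin D → ℂ) (γ : ι → ℂ) (ρ : ℂ) (q : Fin D → ℂ) :
    CapSolves F f γ ρ q
      (phiCF (aDiag F) δ δ' (sigma F) (fun κ => q κ - srcQ F f γ κ) (-ρ - srcM F f))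
      (cCF (aDiag F) δ δ' (sigma F) (fun κ => q κ - srcQ F f γ κ) (-ρ - srcM F f)) :=
  (capSolves_iff_closedForm F δ δ' hT1 hT2 ha hσ hh f γ ρ q _ _).2 ⟨rfl, rfl⟩

/-! ## §4 Injectivity: capacitance and arrow systems -/

/-- [folklore] With zero sources the Q-row source term vanishes. -/
theorem srcQ_zero [Fintype ι] (κ : Fin D) : srcQ F 0 0 κ = 0 := by
  simp [srcQ, dot]

/-- [folklore] With zero sources the M-row source term vanishes. -/
theorem srcM_zero [Fintype ι] : srcM F 0 = 0 := by
  simp [srcM, dot]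

/-- [folklore] The closed form is homogeneous: zero right-hand sides give `u = 0`. -/
theorem uCF_zero (a δ δ' : Fin D → ℂ) (σ : ℂ) : uCF a δ δ' σ 0 0 = 0 := by
  simp [uCF]

/-- [folklore] … give `c = 0`. -/
theorem cCF_zero (a δ δ' : Fin D → ℂ) (σ : ℂ) : cCF a δ δ' σ 0 0 = 0 := by
  simp [cCF, uCF_zero]

/-- [folklore] … and give `φ = 0`. -/
theorem phiCF_zero (a δ δ' : Fin D → ℂ) (σ : ℂ) : phiCF a δ δ' σ 0 0 = 0 := by
  funext κ; simp [phiCF, uCF_zero]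

/-- [folklore] **THE HOMOGENEOUS CAPACITANCE SYSTEM IS INJECTIVE** under (T1)/(T2), `a_κ ≠ 0`, `σ ≠ 0`, `h ≠ 0`. -/
theorem cap_injective [Fintype ι] (δ δ' : Fin D → ℂ) (hT1 : ∀ m κ, F.wQ m κ * F.dd m κ = F.wM m * δ κ)
    (hT2 : ∀ m κ, F.db m κ * F.wE m κ = F.wG m * δ' κ) (ha : ∀ κ, aDiag F κ ≠ 0) (hσ : sigma F ≠ 0)
    (hh : hSum (aDiag F) δ δ' ≠ 0) (φ : Fin D → ℂ) (c : ℂ) (hcap : CapSolves F 0 0 0 0 φ c) : φ = 0 ∧ c = 0 := by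
  have hb := (capSolves_iff_bordered F δ δ' hT1 hT2 0 0 0 0 φ c).1 hcap
  have hb' : (∀ κ, aDiag F κ * φ κ - sigma F / 2 * δ κ * dot δ' φ + sigma F * δ κ * c = (0 : Fin D → ℂ) κ)
      ∧ sigma F * dot δ' φ = 0 := by
    refine ⟨fun κ => ?_, ?_⟩
    · rw [hb.1 κ, srcQ_zero, sub_zero]
    · rw [hb.2, srcM_zero, neg_zero, sub_zero]
  have h := (bordered_iff_closedForm (aDiag F) δ δ' (sigma F) 0 0 ha hσ hh φ c).1 hb'
  rw [phiCF_zero, cCF_zero] at h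
  exact h

/-- [folklore] **THE HOMOGENEOUS ARROW SYSTEM IS INJECTIVE** under (T1)/(T2), `a_κ ≠ 0`, `σ ≠ 0`, `h ≠ 0` — an invertibility criterion for the per-fibre
arrow system that does not go through the determinant of the fibre matrix (leaf-15's `arrow_injective_iff_cap_injective` BY NAME). -/
theorem arrow_injective [Fintype ι] (δ δ' : Fin D → ℂ) (hT1 : ∀ m κ, F.wQ m κ * F.dd m κ = F.wM m * δ κ)
    (hT2 : ∀ m κ, F.db m κ * F.wE m κ = F.wG m * δ' κ) (ha : ∀ κ, aDiag F κ ≠ 0) (hσ : sigma F ≠ 0)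
    (hh : hSum (aDiag F) δ δ' ≠ 0) (A : ι → Fin D → ℂ) (μ : ι → ℂ) (φ : Fin D → ℂ) (c : ℂ)
    (harr : ArrowSolves F 0 0 0 0 A μ φ c) : A = 0 ∧ μ = 0 ∧ φ = 0 ∧ c = 0 :=
  (arrow_injective_iff_cap_injective F).2 (cap_injective F δ δ' hT1 hT2 ha hσ hh) A μ φ c harr

/-! ## §5 The four blocks of the inverse, explicitly -/

/-- [folklore] `(Cap⁻¹)_φφ κ l = [κ = l]/a_κ − δ_κ δ'_l/(a_κ a_l h)`. -/
noncomputable def invPP (a δ δ' : Fin D → ℂ) (κ l : Fin D) : ℂ :=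
  (if κ = l then 1 / a κ else 0) - δ κ * δ' l / (a κ * a l * hSum a δ δ')

/-- [folklore] `(Cap⁻¹)_φc κ = δ_κ/(a_κ σ h)`. -/
noncomputable def invPc (a δ δ' : Fin D → ℂ) (σ : ℂ) (κ : Fin D) : ℂ := δ κ / (a κ * σ * hSum a δ δ')

/-- [folklore] `(Cap⁻¹)_cφ l = δ'_l/(a_l σ h)`. -/
noncomputable def invcP (a δ δ' : Fin D → ℂ) (σ : ℂ) (l : Fin D) : ℂ := δ' l / (a l * σ * hSum a δ δ')

/-- [folklore] `(Cap⁻¹)_cc = 1/(2σ) − 1/(σ² h)`. -/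
noncomputable def invcc (a δ δ' : Fin D → ℂ) (σ : ℂ) : ℂ := 1 / (2 * σ) - 1 / (σ ^ 2 * hSum a δ δ')

/-- [folklore] **`φ`-BLOCKS**: `phiCF κ = Σ_l (Cap⁻¹)_φφ κ l · Q_l + (Cap⁻¹)_φc κ · R` (an identity of rational expressions; no non-vanishing needed
under Lean's `x / 0 = 0` convention). -/
theorem phiCF_eq_blocks (a δ δ' : Fin D → ℂ) (σ : ℂ) (Q : Fin D → ℂ) (R : ℂ) (κ : Fin D) :
    phiCF a δ δ' σ Q R κ = ∑ l, invPP a δ δ' κ l * Q l + invPc a δ δ' σ κ * R := by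
  have hsum : ∑ l, invPP a δ δ' κ l * Q l = Q κ / a κ - δ κ / (a κ * hSum a δ δ') * ∑ l, δ' l * Q l / a l := by
    simp only [invPP, sub_mul, Finset.sum_sub_distrib, ite_mul, zero_mul, Finset.sum_ite_eq, Finset.mem_univ, if_true]
    congr 1
    · ring
    · rw [Finset.mul_sum]
      exact Finset.sum_congr rfl fun l _ => by ring
  rw [hsum]
  unfold phiCF uCF invPc
  ring

/-- [folklore] **`c`-BLOCKS**: `cCF = Σ_l (Cap⁻¹)_cφ l · Q_l + (Cap⁻¹)_cc · R` (likewise unconditional). -/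
theorem cCF_eq_blocks (a δ δ' : Fin D → ℂ) (σ : ℂ) (Q : Fin D → ℂ) (R : ℂ) :
    cCF a δ δ' σ Q R = ∑ l, invcP a δ δ' σ l * Q l + invcc a δ δ' σ * R := by
  have hsum : ∑ l, invcP a δ δ' σ l * Q l = (1 / (σ * hSum a δ δ')) * ∑ l, δ' l * Q l / a l := by
    rw [Finset.mul_sum]
    exact Finset.sum_congr rfl fun l _ => by unfold invcP; ring
  rw [hsum]
  unfold cCF uCF invcc
  ring

/-! ## §6 No-cancellation bounds of the four blocks -/

/-- [folklore] `‖(Cap⁻¹)_φφ κ l‖ ≤ α + α²ε²η` from `‖a⁻¹‖ ≤ α`, `‖δ‖, ‖δ'‖ ≤ ε`, `‖h⁻¹‖ ≤ η`. -/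
theorem norm_invPP_le (a δ δ' : Fin D → ℂ) {α ε η : ℝ} (hα : ∀ κ, ‖(a κ)⁻¹‖ ≤ α) (hε : ∀ κ, ‖δ κ‖ ≤ ε)
    (hε' : ∀ κ, ‖δ' κ‖ ≤ ε) (hη : ‖(hSum a δ δ')⁻¹‖ ≤ η) (κ l : Fin D) :
    ‖invPP a δ δ' κ l‖ ≤ α + α ^ 2 * ε ^ 2 * η := by
  have hα0 : 0 ≤ α := le_trans (norm_nonneg _) (hα κ)
  have hε0 : 0 ≤ ε := le_trans (norm_nonneg _) (hε κ)
  have h1 : ‖(if κ = l then 1 / a κ else 0 : ℂ)‖ ≤ α := by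
    split_ifs
    · rw [one_div]; exact hα κ
    · rw [norm_zero]; exact hα0
  have h2 : ‖δ κ * δ' l / (a κ * a l * hSum a δ δ')‖ ≤ α ^ 2 * ε ^ 2 * η := by
    have e : δ κ * δ' l / (a κ * a l * hSum a δ δ') = δ κ * δ' l * (a κ)⁻¹ * (a l)⁻¹ * (hSum a δ δ')⁻¹ := by
      rw [div_eq_mul_inv, mul_inv, mul_inv]; ring
    have s2 : ‖δ κ‖ * ‖δ' l‖ ≤ ε * ε := mul_le_mul (hε κ) (hε' l) (norm_nonneg _) hε0
    have s3 : ‖δ κ‖ * ‖δ' l‖ * ‖(a κ)⁻¹‖ ≤ ε * ε * α := mul_le_mul s2 (hα κ) (norm_nonneg _) (mul_nonneg hε0 hε0)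
    have s4 : ‖δ κ‖ * ‖δ' l‖ * ‖(a κ)⁻¹‖ * ‖(a l)⁻¹‖ ≤ ε * ε * α * α :=
      mul_le_mul s3 (hα l) (norm_nonneg _) (mul_nonneg (mul_nonneg hε0 hε0) hα0)
    have s5 : ‖δ κ‖ * ‖δ' l‖ * ‖(a κ)⁻¹‖ * ‖(a l)⁻¹‖ * ‖(hSum a δ δ')⁻¹‖ ≤ ε * ε * α * α * η :=
      mul_le_mul s4 hη (norm_nonneg _) (mul_nonneg (mul_nonneg (mul_nonneg hε0 hε0) hα0) hα0)
    calc ‖δ κ * δ' l / (a κ * a l * hSum a δ δ')‖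
        = ‖δ κ‖ * ‖δ' l‖ * ‖(a κ)⁻¹‖ * ‖(a l)⁻¹‖ * ‖(hSum a δ δ')⁻¹‖ := by rw [e]; simp only [norm_mul]
      _ ≤ ε * ε * α * α * η := s5
      _ = α ^ 2 * ε ^ 2 * η := by ring
  unfold invPP
  exact (norm_sub_le _ _).trans (add_le_add h1 h2)

/-- [folklore] `‖(Cap⁻¹)_φc κ‖ ≤ αεςη`. -/
theorem norm_invPc_le (a δ δ' : Fin D → ℂ) (σ : ℂ) {α ε ς η : ℝ} (hα : ∀ κ, ‖(a κ)⁻¹‖ ≤ α) (hε : ∀ κ, ‖δ κ‖ ≤ ε)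
    (hς : ‖σ⁻¹‖ ≤ ς) (hη : ‖(hSum a δ δ')⁻¹‖ ≤ η) (κ : Fin D) :
    ‖invPc a δ δ' σ κ‖ ≤ α * ε * ς * η := by
  have hα0 : 0 ≤ α := le_trans (norm_nonneg _) (hα κ)
  have hε0 : 0 ≤ ε := le_trans (norm_nonneg _) (hε κ)
  have hς0 : 0 ≤ ς := le_trans (norm_nonneg _) hς
  have e : invPc a δ δ' σ κ = δ κ * (a κ)⁻¹ * σ⁻¹ * (hSum a δ δ')⁻¹ := by
    unfold invPc; rw [div_eq_mul_inv, mul_inv, mul_inv]; ring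
  have s2 : ‖δ κ‖ * ‖(a κ)⁻¹‖ ≤ ε * α := mul_le_mul (hε κ) (hα κ) (norm_nonneg _) hε0
  have s3 : ‖δ κ‖ * ‖(a κ)⁻¹‖ * ‖σ⁻¹‖ ≤ ε * α * ς := mul_le_mul s2 hς (norm_nonneg _) (mul_nonneg hε0 hα0)
  have s4 : ‖δ κ‖ * ‖(a κ)⁻¹‖ * ‖σ⁻¹‖ * ‖(hSum a δ δ')⁻¹‖ ≤ ε * α * ς * η :=
    mul_le_mul s3 hη (norm_nonneg _) (mul_nonneg (mul_nonneg hε0 hα0) hς0)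
  calc ‖invPc a δ δ' σ κ‖ = ‖δ κ‖ * ‖(a κ)⁻¹‖ * ‖σ⁻¹‖ * ‖(hSum a δ δ')⁻¹‖ := by rw [e]; simp only [norm_mul]
    _ ≤ ε * α * ς * η := s4
    _ = α * ε * ς * η := by ring

/-- [folklore] `‖(Cap⁻¹)_cφ l‖ ≤ αεςη`. -/
theorem norm_invcP_le (a δ δ' : Fin D → ℂ) (σ : ℂ) {α ε ς η : ℝ} (hα : ∀ κ, ‖(a κ)⁻¹‖ ≤ α) (hε' : ∀ κ, ‖δ' κ‖ ≤ ε)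
    (hς : ‖σ⁻¹‖ ≤ ς) (hη : ‖(hSum a δ δ')⁻¹‖ ≤ η) (l : Fin D) :
    ‖invcP a δ δ' σ l‖ ≤ α * ε * ς * η := by
  have hα0 : 0 ≤ α := le_trans (norm_nonneg _) (hα l)
  have hε0 : 0 ≤ ε := le_trans (norm_nonneg _) (hε' l)
  have hς0 : 0 ≤ ς := le_trans (norm_nonneg _) hς
  have e : invcP a δ δ' σ l = δ' l * (a l)⁻¹ * σ⁻¹ * (hSum a δ δ')⁻¹ := by
    unfold invcP; rw [div_eq_mul_inv, mul_inv, mul_inv]; ring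
  have s2 : ‖δ' l‖ * ‖(a l)⁻¹‖ ≤ ε * α := mul_le_mul (hε' l) (hα l) (norm_nonneg _) hε0
  have s3 : ‖δ' l‖ * ‖(a l)⁻¹‖ * ‖σ⁻¹‖ ≤ ε * α * ς := mul_le_mul s2 hς (norm_nonneg _) (mul_nonneg hε0 hα0)
  have s4 : ‖δ' l‖ * ‖(a l)⁻¹‖ * ‖σ⁻¹‖ * ‖(hSum a δ δ')⁻¹‖ ≤ ε * α * ς * η :=
    mul_le_mul s3 hη (norm_nonneg _) (mul_nonneg (mul_nonneg hε0 hα0) hς0)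
  calc ‖invcP a δ δ' σ l‖ = ‖δ' l‖ * ‖(a l)⁻¹‖ * ‖σ⁻¹‖ * ‖(hSum a δ δ')⁻¹‖ := by rw [e]; simp only [norm_mul]
    _ ≤ ε * α * ς * η := s4
    _ = α * ε * ς * η := by ring

/-- [folklore] `‖(Cap⁻¹)_cc‖ ≤ ς/2 + ς²η`. -/
theorem norm_invcc_le (a δ δ' : Fin D → ℂ) (σ : ℂ) {ς η : ℝ} (hς : ‖σ⁻¹‖ ≤ ς) (hη : ‖(hSum a δ δ')⁻¹‖ ≤ η) :
    ‖invcc a δ δ' σ‖ ≤ ς / 2 + ς ^ 2 * η := by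
  have hς0 : 0 ≤ ς := le_trans (norm_nonneg _) hς
  have e2 : ‖(2 : ℂ)⁻¹‖ = 2⁻¹ := by simp
  have h1 : ‖(1 / (2 * σ) : ℂ)‖ ≤ ς / 2 := by
    rw [one_div, mul_inv, norm_mul, e2]
    have := mul_le_mul_of_nonneg_left hς (by norm_num : (0 : ℝ) ≤ 2⁻¹)
    linarith
  have h2 : ‖(1 / (σ ^ 2 * hSum a δ δ') : ℂ)‖ ≤ ς ^ 2 * η := by
    have e : (1 / (σ ^ 2 * hSum a δ δ') : ℂ) = σ⁻¹ * σ⁻¹ * (hSum a δ δ')⁻¹ := by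
      rw [one_div, mul_inv, sq, mul_inv]
    have s2 : ‖σ⁻¹‖ * ‖σ⁻¹‖ ≤ ς * ς := mul_le_mul hς hς (norm_nonneg _) hς0
    have s3 : ‖σ⁻¹‖ * ‖σ⁻¹‖ * ‖(hSum a δ δ')⁻¹‖ ≤ ς * ς * η := mul_le_mul s2 hη (norm_nonneg _) (mul_nonneg hς0 hς0)
    calc ‖(1 / (σ ^ 2 * hSum a δ δ') : ℂ)‖ = ‖σ⁻¹‖ * ‖σ⁻¹‖ * ‖(hSum a δ δ')⁻¹‖ := by rw [e]; simp only [norm_mul]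
      _ ≤ ς * ς * η := s3
      _ = ς ^ 2 * η := by ring
  unfold invcc
  exact (norm_sub_le _ _).trans (add_le_add h1 h2)

end Summit.QuantumFields.BalabanUV.Beta.GAN24.CapacitanceClosedForm
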